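import Summits.NavierStokesRegularity.NavierStokesRegularity.Theorems.ScenarioCensusRowA7hbShear
import Summits.NavierStokesRegularity.NavierStokesRegularity.Theorems.ScenarioCensusRowA7hbVorticityFlux
import Literature.Analysis.FluidPDE.KNSSLineInvariantLiouville
import HarnessLib

/-!
# Scenario census, row A7hb — part «Vorticity»: B1 PROVED (the vertical vorticity of a horizontal-valued
# bounded ancient mild solution vanishes), hence `Row_A7hb` from the shear step alone

Re-homed for the scenario census (typer seat ns-census-typer-1 g5; lead ORDER 2026-08-28T14:43Z) = the port-ready extract 2/2
(sha16 c1a0bc61bf39a218, verbatim; the typer only switches the import `…RowA7hbPlanar` → `…RowA7hbShear` and appends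
`row_A7hb_holds` + the census key `ScenarioCensus.row_A7hb_excluded`) of ns-idea-2 g9's LINE «horizontal-meter» REV 7
(line file sha16 1474c686879270a9; evidence ⟨stmt-NavierStokesRegularity-10661⟩ n_evidence 51/53), the REV 6 → REV 7 DELTA
written AGAINST THE TREE: it imports part 1/2 `ScenarioCensusRowA7hbVorticityFlux` (`B1.curlThird_square_bound`,
`B1.curlThird_nonpos_of_lemma21`) and `ScenarioCensusRowA7hbShear` ⊇ `…Planar` (parts 3–4 of the census re-homing: the gauge class
`IsBoundedKNSSMild`, `IsHorizontalValued`, `e3`, the obligation Props `VerticalVorticityVanishesBounded` (B1),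
`ShearIsConstant` (B2b), `IsBoundedKNSSMild.isBoundedAncientMildSolution`, `row_A7hb_of_stubs'`) and ONE new
Literature import, `KNSSLineInvariantLiouville` (the tree's 2.5D-Liouville infrastructure: §4 regularity
representative, `clm_curl_family`, `vorticity_integrand_intervalIntegrable`, `KNSS2009_lemma21_halfball_holds`,
`repr_sub_eq_sub_of_ae`).  Proposed tree path
`Summits/NavierStokesRegularity/NavierStokesRegularity/Theorems/ScenarioCensusRowA7hbVorticity.lean`
(namespace `…ScenarioCensus.HorizontalMeter`, the line's `ℝ³` notation spelled out).

PROVED here (standard axioms): `verticalVorticityVanishesBounded_holds : VerticalVorticityVanishesBounded`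
— KNSS 2009 Theorem 5.1's sup / Lemma 2.1 / flux argument ONE DIMENSION UP: for `u` in the bounded KNSS gauge
with `u·e₃ ≡ 0`, the §4 representative `u = U + b(t)` (`KNSS2009_regularity_boundedWeak_ancient_holds`) has
`U₂(t,·)` constant, so the vertical vorticity `(curl U)₂` has NO stretching and lies in the class of Lemma 2.1
with drift `U + b` (`B1.clm_curl_nonpos_of_curlThird` = the proof body of the tree's `clm_curl_nonpos`
verbatim up to its last line); if `sup (curl U)₂ = M₁ > 0`, Lemma 2.1 gives parabolic balls of every radius on
which it is `≥ M₁/2`, and Green's formula on the horizontal square of half-side `R/4` inside such a ball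
(`B1.curlThird_square_bound`, Mathlib `integral2_divergence_prod_of_hasFDerivAt`) gives `M₁ R ≤ 16 sup‖U‖` —
absurd; symmetrically for `−(curl U)₂ = (curl (−U))₂`.  Consequence: `row_A7hb_of_shearIsConstant :
ShearIsConstant → Row_A7hb` (by the tree's `row_A7hb_of_stubs'`); with part «Shear» (`shearIsConstant`, REV 6
delta) in scope, `Row_A7hb` is a theorem: a bounded ancient mild solution in the KNSS gauge whose velocity
stays in one fixed plane is a constant (the "2D-VALUED" companion of KNSS Theorem 5.1).

No census value is asserted here (the lead books values); NS regularity is NOT proved; no summit statement is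
proved by this file.
-/

set_option linter.dupNamespace false

noncomputable section

namespace Summit.NavierStokesRegularity.NavierStokesRegularity.Theorems.ScenarioCensus.HorizontalMeter

open Set Function Filter Topology MeasureTheory
open scoped RealInnerProductSpace InnerProductSpace NNReal Laplacian
open Literature.Analysis Literature.Analysis.FluidPDE

section B1Proof

open InnerProductSpace WithLp intervalIntegral
open scoped ContDiff

namespace B1

/-! ### The §4 representative: `ℓ ∘ curl U` a third curl component, no stretching ⇒ `ℓ(curl U) ≤ 0` -/

variable {U : ℝ → (EuclideanSpace ℝ (Fin 3)) → (EuclideanSpace ℝ (Fin 3))} {b : ℝ → (EuclideanSpace ℝ (Fin 3))}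

/-- **`ℓ(curl U) ≤ 0` for the §4 representative when `ℓ` kills the velocity gradient and
`ℓ(curl U(t))` is a third curl component of a bounded `C¹` field** — the variant of
`clm_curl_nonpos` (KNSSLineInvariantVorticity) with the one-dimensional representation
`ℓ(curl U(t)) = ∂ₑ w_t` replaced by `ℓ(curl U(t)) = (curl V_t)₂`, `‖V_t‖ ≤ K`: the scalar
`ℓ(curl U)` lies in the class of Lemma 2.1 with drift `U + b` exactly as there (bounds and joint
continuity from `clm_curl_family`, the equation from (4.5) through `ℓ`, the stretching term killed
by `hkill`), and `curlThird_nonpos_of_lemma21` applies. Proof body = that of `clm_curl_nonpos`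
verbatim up to the last line. [cite: KochNadirashviliSereginSverak2009, §4 (4.5) p. 8 and proof of Thm 5.1 (p. 9)] -/
theorem clm_curl_nonpos_of_curlThird (ℓ : (EuclideanSpace ℝ (Fin 3)) →L[ℝ] ℝ) (hℓ : ‖ℓ‖ ≤ 1) {K : ℝ}
    (hbm : Measurable b) {Cb : ℝ} (hCb : ∀ t, ‖b t‖ ≤ Cb) (hUm : Measurable (uncurry U))
    (hsmooth : ∀ t < 0, ContDiff ℝ ∞ (U t)) {C : ℕ → ℝ}
    (hC : ∀ k : ℕ, ∀ t < 0, ∀ x, ‖iteratedFDeriv ℝ k (U t) x‖ ≤ C k) {L : ℕ → ℝ}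
    (hL : ∀ k : ℕ, 1 ≤ k → ∀ s < 0, ∀ t < 0, ∀ x,
      ‖iteratedFDeriv ℝ k (U t) x - iteratedFDeriv ℝ k (U s) x‖ ≤ L k * |t - s|)
    (hvort : ∀ x, ∀ s t : ℝ, s ≤ t → t < 0 →
      curl (U t) x - curl (U s) x =
        ∫ τ in s..t, ((Δ (curl (U τ))) x - fderiv ℝ (curl (U τ)) x (U τ x + b τ) +
          fderiv ℝ (U τ) x (curl (U τ) x)))
    (hkill : ∀ τ < 0, ∀ x v : (EuclideanSpace ℝ (Fin 3)), ℓ (fderiv ℝ (U τ) x v) = 0)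
    (hrep : ∀ t < 0, ∃ V : (EuclideanSpace ℝ (Fin 3)) → (EuclideanSpace ℝ (Fin 3)), ContDiff ℝ 1 V ∧
      (∀ x, ‖V x‖ ≤ K) ∧ ∀ x, ℓ (curl (U t) x) = curl V x 2) :
    ∀ t < 0, ∀ x, ℓ (curl (U t) x) ≤ 0 := by
  obtain ⟨hg, hgC, hgL⟩ := clm_curl_family ℓ hℓ hsmooth hC hL
  set g : ℝ → (EuclideanSpace ℝ (Fin 3)) → ℝ := fun t y => ℓ (curl (U t) y) with hg_def
  set a : ℝ → (EuclideanSpace ℝ (Fin 3)) → (EuclideanSpace ℝ (Fin 3)) := fun t y => U t y + b t with ha_def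
  have ham : Measurable (uncurry a) := by
    have : uncurry a = fun p : ℝ × (EuclideanSpace ℝ (Fin 3)) => uncurry U p + b p.1 := by
      funext p; rfl
    rw [this]
    exact hUm.add (hbm.comp measurable_fst)
  have haA : ∀ t < 0, ∀ y, ‖a t y‖ ≤ C 0 + Cb := fun t ht y => by
    have h0 := hC 0 t ht y
    rw [norm_iteratedFDeriv_zero] at h0
    exact (norm_add_le _ _).trans (add_le_add h0 (hCb t))
  have hg2 : ∀ t < 0, ContDiff ℝ 2 (g t) := fun t ht => (hg t ht).of_le (by norm_cast)
  have hg1 : ∀ t < 0, ContDiff ℝ 1 (g t) := fun t ht => (hg t ht).of_le (by norm_cast)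
  have hgb : ∃ C' : ℝ, ∀ t < 0, ∀ y, |g t y| ≤ C' := ⟨‖curlCLM‖ * C 1, fun t ht y => by
    have h := hgC 0 t ht y
    rwa [norm_iteratedFDeriv_zero, Real.norm_eq_abs] at h⟩
  have hgD : ∀ t < 0, ∀ y, ‖fderiv ℝ (g t) y‖ ≤ ‖curlCLM‖ * C 2 := fun t ht y => by
    rw [norm_fderiv_eq_norm_iteratedFDeriv_one]; exact hgC 1 t ht y
  have hgΔ : ∀ t < 0, ∀ y, |(Δ (g t)) y| ≤ 3 * (‖curlCLM‖ * C 3) := fun t ht y => by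
    have h := norm_iteratedFDeriv_laplacian_le (hg t ht) 0 y
    rw [norm_iteratedFDeriv_zero, Real.norm_eq_abs, finrank_euclideanSpace_fin] at h
    refine h.trans ?_
    push_cast
    exact mul_le_mul_of_nonneg_left (hgC 2 t ht y) (by norm_num)
  have hfD : ∃ C' : ℝ, ∀ t < 0, ∀ y, ‖fderiv ℝ (g t) y‖ ≤ C' ∧ |(Δ (g t)) y| ≤ C' :=
    ⟨max (‖curlCLM‖ * C 2) (3 * (‖curlCLM‖ * C 3)), fun t ht y =>
      ⟨(hgD t ht y).trans (le_max_left _ _), (hgΔ t ht y).trans (le_max_right _ _)⟩⟩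
  -- time-Lipschitz bounds for `Dg` and `Δg`, hence joint continuity
  have hDlip : ∀ s ∈ Iio (0 : ℝ), ∀ t ∈ Iio (0 : ℝ), ∀ y,
      ‖fderiv ℝ (g t) y - fderiv ℝ (g s) y‖ ≤ ‖curlCLM‖ * L 2 * |t - s| := by
    intro s hs t ht y
    have hs' : s < 0 := hs
    have ht' : t < 0 := ht
    have e1 : fderiv ℝ (g t) y - fderiv ℝ (g s) y = fderiv ℝ (g t - g s) y :=
      (fderiv_sub (((hg1 t ht').differentiable one_ne_zero) y)
        (((hg1 s hs').differentiable one_ne_zero) y)).symm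
    rw [e1, norm_fderiv_eq_norm_iteratedFDeriv_one,
      iteratedFDeriv_sub_apply ((hg t ht').of_le (natCast_le_contDiff_infty 1)).contDiffAt
        ((hg s hs').of_le (natCast_le_contDiff_infty 1)).contDiffAt]
    exact hgL 1 s hs' t ht' y
  have hΔlip : ∀ s ∈ Iio (0 : ℝ), ∀ t ∈ Iio (0 : ℝ), ∀ y,
      ‖(Δ (g t)) y - (Δ (g s)) y‖ ≤ 3 * ‖curlCLM‖ * L 3 * |t - s| := by
    intro s hs t ht y
    have hs' : s < 0 := hs
    have ht' : t < 0 := ht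
    rw [← (hg2 t ht').contDiffAt.laplacian_sub (hg2 s hs').contDiffAt]
    have hsub : ContDiff ℝ ∞ (g t - g s) := (hg t ht').sub (hg s hs')
    have h := norm_iteratedFDeriv_laplacian_le hsub 0 y
    rw [norm_iteratedFDeriv_zero, finrank_euclideanSpace_fin] at h
    have h2 : ‖iteratedFDeriv ℝ 2 (g t - g s) y‖ ≤ ‖curlCLM‖ * L 3 * |t - s| := by
      rw [iteratedFDeriv_sub_apply ((hg t ht').of_le (natCast_le_contDiff_infty 2)).contDiffAt
        ((hg s hs').of_le (natCast_le_contDiff_infty 2)).contDiffAt]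
      exact hgL 2 s hs' t ht' y
    refine h.trans ?_
    push_cast
    calc (3 : ℝ) * ‖iteratedFDeriv ℝ 2 (g t - g s) y‖
        ≤ 3 * (‖curlCLM‖ * L 3 * |t - s|) := mul_le_mul_of_nonneg_left h2 (by norm_num)
      _ = 3 * ‖curlCLM‖ * L 3 * |t - s| := by ring
  have hcD : ContinuousOn (fun p : ℝ × (EuclideanSpace ℝ (Fin 3)) => fderiv ℝ (g p.1) p.2) (Iio 0 ×ˢ univ) :=
    continuousOn_prod_of_lipschitz_time (ψ := fun t y => fderiv ℝ (g t) y) hDlip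
      fun t ht => (hg1 t ht).continuous_fderiv one_ne_zero
  have hcΔ : ContinuousOn (fun p : ℝ × (EuclideanSpace ℝ (Fin 3)) => (Δ (g p.1)) p.2) (Iio 0 ×ˢ univ) :=
    continuousOn_prod_of_lipschitz_time (ψ := fun t y => (Δ (g t)) y) hΔlip
      fun t ht => continuous_laplacian (hg2 t ht)
  -- the equation: (4.5) through `ℓ`, the stretching term killed by `hkill`
  have heq : ∀ y, ∀ s t : ℝ, s ≤ t → t < 0 →
      g t y - g s y = ∫ τ in s..t, ((Δ (g τ)) y - fderiv ℝ (g τ) y (a τ y)) := by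
    intro y s t hst ht
    have hint := vorticity_integrand_intervalIntegrable hsmooth hC hL hUm hbm hCb y hst ht
    have h1 : g t y - g s y = ℓ (curl (U t) y - curl (U s) y) := by
      simp only [hg_def, map_sub]
    rw [h1, hvort y s t hst ht, ← ℓ.intervalIntegral_comp_comm hint]
    refine intervalIntegral.integral_congr fun τ hτ => ?_
    have hτ0 : τ < 0 := by
      rw [uIcc_of_le hst] at hτ
      exact hτ.2.trans_lt ht
    have hcurl2 : ContDiff ℝ 2 (curl (U τ)) :=
      contDiff_curl (n := 2) ((hsmooth τ hτ0).of_le (by norm_cast))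
    have eΔ : ℓ ((Δ (curl (U τ))) y) = (Δ (g τ)) y := by
      have h := hcurl2.contDiffAt.laplacian_CLM_comp_left (l := ℓ) (x := y)
      rw [Function.comp_apply] at h
      exact h.symm
    have eD : ∀ v, ℓ (fderiv ℝ (curl (U τ)) y v) = fderiv ℝ (g τ) y v := by
      intro v
      have hd : DifferentiableAt ℝ (curl (U τ)) y := (hcurl2.differentiable two_ne_zero) y
      have hc : HasFDerivAt (⇑ℓ ∘ curl (U τ)) (ℓ.comp (fderiv ℝ (curl (U τ)) y)) y :=
        ℓ.hasFDerivAt.comp y hd.hasFDerivAt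
      have hc' : HasFDerivAt (g τ) (ℓ.comp (fderiv ℝ (curl (U τ)) y)) y := hc
      rw [hc'.fderiv]
      rfl
    have hsplit : ℓ ((Δ (curl (U τ))) y - fderiv ℝ (curl (U τ)) y (U τ y + b τ) +
          fderiv ℝ (U τ) y (curl (U τ) y)) =
        ℓ ((Δ (curl (U τ))) y) - ℓ (fderiv ℝ (curl (U τ)) y (U τ y + b τ)) +
          ℓ (fderiv ℝ (U τ) y (curl (U τ) y)) := by
      rw [ℓ.map_add, ℓ.map_sub]
    rw [hsplit, eΔ, eD, hkill τ hτ0, add_zero]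
  exact curlThird_nonpos_of_lemma21 ham haA hgb hg2 hfD hcD hcΔ heq hrep

/-! ### The vertical vorticity of a §4 representative with constant third component vanishes -/

/-- A coordinate of a field: `(DV(x)v)ᵢ = D(Vᵢ)(x)v` (local copy of the private
`fderiv_apply_coord_fin3` of KNSSLineInvariantVorticity). [folklore] -/
theorem fderiv_apply_coord3 {V : (EuclideanSpace ℝ (Fin 3)) → (EuclideanSpace ℝ (Fin 3))} {x : (EuclideanSpace ℝ (Fin 3))} (hV : DifferentiableAt ℝ V x) (i : Fin 3)
    (v : (EuclideanSpace ℝ (Fin 3))) : fderiv ℝ V x v i = fderiv ℝ (fun y => V y i) x v := by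
  have h : HasFDerivAt (⇑(EuclideanSpace.proj (𝕜 := ℝ) i) ∘ V)
      ((EuclideanSpace.proj i).comp (fderiv ℝ V x)) x :=
    (EuclideanSpace.proj i).hasFDerivAt.comp x hV.hasFDerivAt
  have h' : HasFDerivAt (fun y => V y i) ((EuclideanSpace.proj i).comp (fderiv ℝ V x)) x := h
  rw [h'.fderiv]
  rfl

/-- **The vertical vorticity of the §4 representative of a horizontal-valued solution vanishes.**
Let `U, b` carry the clauses of `KNSS2009_regularity_boundedWeak_ancient` (as in
`repr_const_of_planar_const`, the divergence clause not needed), and suppose the third component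
`U₂(t, ·)` is constant in space at every `t < 0`. Then `(curl U(t))₂ = 0` everywhere: the linear
forms `± proj₂` kill the velocity gradient (no stretching of the vertical vorticity), and
`± (curl U(t))₂ = (curl (±U(t)))₂` are third curl components of the bounded `C¹` fields `±U(t)`, so
`± (curl U)₂ ≤ 0` by `clm_curl_nonpos_of_curlThird` (KNSS 2009 Thm 5.1's argument one dimension
up). [cite: KochNadirashviliSereginSverak2009, proof of Thm 5.1 (arXiv p. 9), §4 (p. 8), Lemma 2.1 (p. 5)] -/
theorem repr_curlThird_eq_zero (hbm : Measurable b) (hbC : ∃ C : ℝ, ∀ t, ‖b t‖ ≤ C)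
    (hUm : Measurable (uncurry U)) (hsmooth : ∀ t < 0, ContDiff ℝ ∞ (U t))
    (hbd : ∀ k : ℕ, ∃ C : ℝ, ∀ t < 0, ∀ x, ‖iteratedFDeriv ℝ k (U t) x‖ ≤ C)
    (hlip : ∀ k : ℕ, 1 ≤ k → ∃ L : ℝ, ∀ s < 0, ∀ t < 0, ∀ x,
      ‖iteratedFDeriv ℝ k (U t) x - iteratedFDeriv ℝ k (U s) x‖ ≤ L * |t - s|)
    (hvort : ∀ x, ∀ s t : ℝ, s ≤ t → t < 0 →
      curl (U t) x - curl (U s) x =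
        ∫ τ in s..t, ((Δ (curl (U τ))) x - fderiv ℝ (curl (U τ)) x (U τ x + b τ) +
          fderiv ℝ (U τ) x (curl (U τ) x)))
    (h3 : ∀ t < 0, ∀ x : (EuclideanSpace ℝ (Fin 3)), U t x 2 = U t 0 2) :
    ∀ t < 0, ∀ x : (EuclideanSpace ℝ (Fin 3)), curl (U t) x 2 = 0 := by
  choose C hC using hbd
  have hlip' : ∀ k : ℕ, ∃ L : ℝ, 1 ≤ k → ∀ s < 0, ∀ t < 0, ∀ x,
      ‖iteratedFDeriv ℝ k (U t) x - iteratedFDeriv ℝ k (U s) x‖ ≤ L * |t - s| := by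
    intro k
    by_cases hk : 1 ≤ k
    · obtain ⟨L, hL⟩ := hlip k hk
      exact ⟨L, fun _ => hL⟩
    · exact ⟨0, fun h => absurd h hk⟩
  choose L hL using hlip'
  obtain ⟨Cb, hCb⟩ := hbC
  have hdiff : ∀ t < 0, Differentiable ℝ (U t) := fun t ht =>
    (hsmooth t ht).differentiable (by simp)
  -- the third component has zero gradient: no stretching of the vertical vorticity
  have hD2 : ∀ t < 0, ∀ x v : (EuclideanSpace ℝ (Fin 3)), fderiv ℝ (U t) x v 2 = 0 := by
    intro t ht x v
    rw [fderiv_apply_coord3 (hdiff t ht x)]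
    have : (fun y => U t y 2) = fun _ => U t 0 2 := funext fun y => h3 t ht y
    rw [this, fderiv_const_apply]
    rfl
  have nP : ‖(EuclideanSpace.proj (2 : Fin 3) : (EuclideanSpace ℝ (Fin 3)) →L[ℝ] ℝ)‖ ≤ 1 :=
    ContinuousLinearMap.opNorm_le_bound _ zero_le_one fun v => by
      rw [one_mul]; simpa using PiLp.norm_apply_le v 2
  have nPn : ‖-(EuclideanSpace.proj (2 : Fin 3) : (EuclideanSpace ℝ (Fin 3)) →L[ℝ] ℝ)‖ ≤ 1 := by
    rw [norm_neg]; exact nP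
  have kill2 : ∀ τ < 0, ∀ x v : (EuclideanSpace ℝ (Fin 3)),
      (EuclideanSpace.proj (2 : Fin 3) : (EuclideanSpace ℝ (Fin 3)) →L[ℝ] ℝ) (fderiv ℝ (U τ) x v) = 0 :=
    fun τ hτ x v => hD2 τ hτ x v
  have kill2n : ∀ τ < 0, ∀ x v : (EuclideanSpace ℝ (Fin 3)),
      (-(EuclideanSpace.proj (2 : Fin 3) : (EuclideanSpace ℝ (Fin 3)) →L[ℝ] ℝ)) (fderiv ℝ (U τ) x v) = 0 :=
    fun τ hτ x v => by rw [neg_apply, kill2 τ hτ x v, neg_zero]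
  -- `± (curl U(t))₂` are third curl components of the bounded `C¹` fields `± U(t)`
  have hV1 : ∀ t < 0, ContDiff ℝ 1 (U t) := fun t ht => (hsmooth t ht).of_le (by norm_cast)
  have hVK : ∀ t < 0, ∀ x, ‖U t x‖ ≤ C 0 := fun t ht x => by
    have h := hC 0 t ht x
    rwa [norm_iteratedFDeriv_zero] at h
  have rep : ∀ t < 0, ∃ V : (EuclideanSpace ℝ (Fin 3)) → (EuclideanSpace ℝ (Fin 3)), ContDiff ℝ 1 V ∧
      (∀ x, ‖V x‖ ≤ C 0) ∧ ∀ x, (EuclideanSpace.proj (2 : Fin 3) : (EuclideanSpace ℝ (Fin 3)) →L[ℝ] ℝ)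
        (curl (U t) x) = curl V x 2 :=
    fun t ht => ⟨U t, hV1 t ht, hVK t ht, fun x => rfl⟩
  have repn : ∀ t < 0, ∃ V : (EuclideanSpace ℝ (Fin 3)) → (EuclideanSpace ℝ (Fin 3)), ContDiff ℝ 1 V ∧
      (∀ x, ‖V x‖ ≤ C 0) ∧ ∀ x, (-(EuclideanSpace.proj (2 : Fin 3) : (EuclideanSpace ℝ (Fin 3)) →L[ℝ] ℝ))
        (curl (U t) x) = curl V x 2 :=
    fun t ht => ⟨fun y => -U t y, (hV1 t ht).neg, fun x => by rw [norm_neg]; exact hVK t ht x,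
      fun x => by
        rw [neg_apply, curl_fun_neg', PiLp.neg_apply]
        rfl⟩
  -- Lemma 2.1 twice
  have A := clm_curl_nonpos_of_curlThird _ nP hbm hCb hUm hsmooth hC hL hvort kill2 rep
  have An := clm_curl_nonpos_of_curlThird _ nPn hbm hCb hUm hsmooth hC hL hvort kill2n repn
  intro t ht x
  have h1 : curl (U t) x 2 ≤ 0 := A t ht x
  have h2 : -(curl (U t) x 2) ≤ 0 := An t ht x
  linarith

end B1

/-- **B1 PROVED (LINE «horizontal-meter» REV 7) — the vertical vorticity of a horizontal-valued bounded ancient mild solution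
vanishes.**  For `u` in the bounded KNSS-gauge class with `u·e₃ ≡ 0`: `u` is a bounded ancient mild
solution in duality form (`IsBoundedKNSSMild.isBoundedAncientMildSolution`, P1), hence a bounded weak
solution, so KNSS §4 (`KNSS2009_regularity_boundedWeak_ancient_holds`) furnishes the representative
`u = U + b(t)` with all derivative bounds and the integrated vorticity equation (4.5); `U(t) − u(t)` is a
spatial constant at every time (`repr_sub_eq_sub_of_ae`), so `U₂(t, ·)` is constant and
`curl u(t) = curl U(t)`; and `(curl U)₂ ≡ 0` by `B1.repr_curlThird_eq_zero` — KNSS Theorem 5.1's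
sup / Lemma 2.1 / flux argument ONE DIMENSION UP: the vertical vorticity has no stretching, lies in the
class of Lemma 2.1 with drift `U + b`, and a third curl component of a bounded field that is `≥ M₁/2`
on parabolic balls of every radius contradicts Green's formula on horizontal squares
(`B1.curlThird_square_bound`: `M₁ R ≤ 16 sup‖U‖`).  No summit statement is proved. [cite: KochNadirashviliSereginSverak2009, Thm 5.1 (arXiv:0709.3599 p. 9), §4 (p. 8), Lemma 2.1 (p. 5)] -/
theorem verticalVorticityVanishesBounded_holds : VerticalVorticityVanishesBounded := by
  intro u hu hh t ht y
  have hcont : ContinuousOn (uncurry u) (Iio 0 ×ˢ univ) := hu.1.continuousOn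
  have hBA : IsBoundedAncientMildSolution 1 u := hu.isBoundedAncientMildSolution
  -- `u` is a bounded weak solution; its §4 representative
  have hmeas : AEStronglyMeasurable (uncurry u)
      ((volume : Measure (ℝ × (EuclideanSpace ℝ (Fin 3)))).restrict (Iio 0 ×ˢ univ)) :=
    hcont.aestronglyMeasurable (measurableSet_Iio.prod MeasurableSet.univ)
  have hsl : ∀ s < 0, AEStronglyMeasurable (u s) volume := fun s hs =>
    (continuous_slice_of_continuousOn_Iio hcont hs).aestronglyMeasurable
  have hw : IsBoundedWeakNSSolutionOn (Iio 0) isOpen_Iio 1 u :=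
    hBA.isBoundedWeakNSSolutionOn one_pos hmeas hsl
  obtain ⟨U, b, hbm, hbC, hUm, hae, hsmooth, -, hbd, hlip, hvort⟩ :=
    KNSS2009_regularity_boundedWeak_ancient_holds hw
  have hsub := repr_sub_eq_sub_of_ae hcont hae hsmooth hlip
  -- the third component of the representative is constant in space at every time
  have h3 : ∀ s < 0, ∀ x : (EuclideanSpace ℝ (Fin 3)), U s x 2 = U s 0 2 := by
    intro s hs x
    have h := congr_arg (fun v : (EuclideanSpace ℝ (Fin 3)) => v 2) (hsub s hs x 0)
    simp only [PiLp.sub_apply] at h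
    rw [hh s hs x, hh s hs 0, sub_self] at h
    linarith
  have hU0 := B1.repr_curlThird_eq_zero hbm hbC hUm hsmooth hbd hlip hvort h3
  -- `u(t) = U(t) + const`, so `curl u(t) = curl U(t)`
  have hfun : u t = fun z => U t z + (u t 0 - U t 0) := by
    funext z
    have h := hsub t ht z 0
    rw [sub_eq_sub_iff_add_eq_add] at h
    rw [add_sub, eq_sub_iff_add_eq]
    exact h.symm
  have hcurl : curl (u t) y = curl (U t) y := by
    rw [hfun]
    simp only [curl, fderiv_add_const]
  rw [hcurl]
  simp [e3, EuclideanSpace.inner_single_right, hU0 t ht y]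

/-- **`Row_A7hb` from B2b alone (B1 discharged).**  With B1 proved, the tree's
`row_A7hb_of_stubs'` leaves only the shear step `ShearIsConstant` (proved in the REV 6 delta,
`ScenarioCensusRowA7hbShear.shearIsConstant`; once that file is in scope,
`row_A7hb_holds : Row_A7hb := row_A7hb_of_shearIsConstant shearIsConstant`).  No summit proved. -/
theorem row_A7hb_of_shearIsConstant (hB2b : ShearIsConstant) : Row_A7hb :=
  row_A7hb_of_stubs' verticalVorticityVanishesBounded_holds hB2b

/-- **Row A7hb CLOSED in kernel (LINE «horizontal-meter» REV 7)**: a bounded ancient mild solution of the KNSS gauge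
class whose velocity is everywhere horizontal (`u·e₃ ≡ 0`) is one constant vector — B1
`verticalVorticityVanishesBounded_holds` + B2a `planarRigidity` + B2b `shearIsConstant` (`ScenarioCensusRowA7hbShear`).
No summit statement is proved. -/
theorem row_A7hb_holds : Row_A7hb := row_A7hb_of_shearIsConstant shearIsConstant

end B1Proof

end Summit.NavierStokesRegularity.NavierStokesRegularity.Theorems.ScenarioCensus.HorizontalMeter

namespace Summit.NavierStokesRegularity.NavierStokesRegularity.Theorems.ScenarioCensus

/-- **Census row A7hb is EXCLUDED-IN-TREE**: `Row_A7hb` (`ScenarioCensusRowA7h`, BY NAME `HorizontalMeter.Row_A7hb`: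
bounded KNSS-gauge ancient mild, NO rate · NO symmetry · horizontal-valued ⇒ `u` is one constant vector) is PROVED by
`HorizontalMeter.row_A7hb_holds` (ns-idea-2 LINE «horizontal-meter» REV 7, re-homed: KNSS Theorem 5.1 one dimension
up — §4 representative, stretching-free vertical vorticity, Lemma 2.1, Green's formula on horizontal squares; planar
harmonic Liouville; caloric decay of shear flows).  The census lead books the value. -/
theorem row_A7hb_excluded : Row_A7hb := HorizontalMeter.row_A7hb_holds

end Summit.NavierStokesRegularity.NavierStokesRegularity.Theorems.ScenarioCensus

end
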